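import Mathlib
import Literature.Computability.AlgebraicComplexity.STPPCharDegreeBound
import Literature.Computability.AlgebraicComplexity.MatrixMultiplicationConjectureForms
import Literature.RepresentationTheory.FiniteGroups.NonabelianCharDegree
import Summits.MatrixMultiplication.MatrixMultiplication.Theses.GroupTheoreticSTPP

/-!
# STPP / TPP with parameters ⇒ `ω ≤ w`: the real-exponent criterion, the full degree-multiset row,
# and the bridges `CNonabelianTPPFamilies ⇒ ω(ℂ) = 2`

Support file for route `MatrixMultiplication/GroupTheoreticSTPP`, crux `stmt-MatrixMultiplication-0597`
(`CNonabelianTPPFamilies`), written for the cell `mm-stpp` (D-0046: certified search for STPP/TPP group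
families).  The tree proves the fundamental inequalities of the group-theoretic method —
Cohn–Kleinberg–Szegedy–Umans 2005 Thm. 1.8 / Cor. 1.9 for one TPP triple (`CKSU2005_thm18_holds`,
`CKSU2005_cor19_holds`) and Thm. 5.5 for an STPP family in an ARBITRARY finite group
(`CohnKleinbergSzegedyUmans2005_thm55_general`: `Σᵢ (|Aᵢ||Bᵢ||Cᵢ|)^{ω/3} ≤ Σ_χ χ(1)^ω`).  Because `ω`
enters both sides, a census row "configuration certified ⇒ `ω ≤ w`" needs a monotonicity argument; the
existing rows (`OmegaCensus/STPPCertificateNonabelian.lean`) do it for RATIONAL `w = a/b` with integer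
witnesses and the weakened right-hand side `d_max^{w−2}|H|`.  This file states the criterion itself:

* `charDegreePowSum_le_maxCharDegree_rpow_mul` — `Σ_χ χ(1)^s ≤ d_max^{s−t} · Σ_χ χ(1)^t` (`t ≤ s`);
* `omega_le_of_stpp_charDegreePowSum` — **full degree-multiset row**: an STPP family with every volume
  `Vᵢ = |Aᵢ||Bᵢ||Cᵢ| ≥ d_max(H)³` and `Σ_χ χ(1)^w < Σᵢ Vᵢ^{w/3}` (real `w`) certifies `ω ≤ w`
  (sharper than the `d_max^{w−2}|H|` row whenever `H` has characters of degree `< d_max`);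
* `omega_le_of_stpp_maxCharDegree`, `omega_le_of_stpp_abelianSubgroup` — the same with the right-hand
  sides `d^{w−2}|H|` (`d ≥ d_max`, volumes `≥ d³`) and `[H:N]^{w−2}|H|` (`N` an abelian subgroup);
* `omega_le_of_tpp_maxCharDegree` — one TPP triple: `d³ ≤ V`, `d^{w−2}|G| < V^{w/3}` ⇒ `ω ≤ w`
  (Cohn–Umans 2003 Cor. 4.2 in certificate form);
* `matrixMultiplication_of_CNonabelianTPPFamilies` — the crux `CNonabelianTPPFamilies` as typed implies
  the summit statement (`ω ≤ 2 + 2ε` for every `ε`), a bridge the route file does not contain;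
* `matrixMultiplication_of_tppFamilies_theta` — the same for the REPAIRED signature `C′` proposed in the
  refuter note on stmt-0597 (degree bound `d_max ≤ V^{θ/3}` with a FIXED `θ < 1`: `ω ≤ 2 + ε/(1−θ)`);
* `matrixMultiplication_of_stppFamilies` — the STPP analogue: for every `ε > 0` a finite group with an
  STPP family of volumes `≥ d³`, `d ≥ d_max`, and `d^ε|H| < Σᵢ Vᵢ^{(2+ε)/3}` ⇒ `ω(ℂ) = 2`.

WHAT THIS IS NOT: no bound on `ω` is proved here; these are the certificate-to-theorem criteria the
census rows of the cell instantiate (instrument), and the bridges recording exactly what a TPP/STPP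
family must achieve to settle the summit.

## References
* H. Cohn, C. Umans, FOCS 2003, arXiv:math/0307321: Def. 2.1, Thm. 4.1, Cor. 4.2, Cor. 4.3.
* H. Cohn, R. Kleinberg, B. Szegedy, C. Umans, FOCS 2005, arXiv:math/0511460: Thm. 1.8, Cor. 1.9,
  Def. 5.1, Thm. 5.5.
-/

-- single-conjunct summit: the mandated namespace repeats `MatrixMultiplication`.
set_option linter.dupNamespace false

noncomputable section

namespace Summit.MatrixMultiplication.MatrixMultiplication.Theorems

namespace STPPCriterion

open Finset Literature.Computability.AlgebraicComplexity Literature.Combinatorics.Additive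
  Literature.RepresentationTheory.FiniteGroups

/-! ### Degree power sums: passing from exponent `s` down to `t ≤ s` -/

/-- **`Σ_χ χ(1)^s ≤ d_max^{s−t} · Σ_χ χ(1)^t`** for a finite group and real `t ≤ s`: every irreducible
degree is `≤ d_max(G)` and positive, so `χ(1)^s = χ(1)^{s−t} χ(1)^t ≤ d_max^{s−t} χ(1)^t`.  (For `t = 2`
this is the tree's `charDegreePowSum_le_maxCharDegree_rpow_mul_card`, the step of Cohn–Umans' Cor. 4.2.)
[cite: CohnUmans2003, Cor. 4.2 (proof)] -/
theorem charDegreePowSum_le_maxCharDegree_rpow_mul (G : Type) [Group G] [Finite G] {s t : ℝ}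
    (hts : t ≤ s) :
    charDegreePowSum G s ≤ (maxCharDegree G : ℝ) ^ (s - t) * charDegreePowSum G t := by
  classical
  have hfin : (irrChars G).Finite := irrChars_finite_holds G
  have hdeg : ∀ χ ∈ hfin.toFinset, ∃ d ∈ charDegrees G, χ 1 = d := fun χ hχ =>
    IsIrrChar.exists_apply_one (hfin.mem_toFinset.mp hχ)
  choose! deg hdegmem hdeg using hdeg
  have hst : 0 ≤ s - t := sub_nonneg.2 hts
  have hterm : ∀ χ ∈ hfin.toFinset,
      (χ 1).re ^ s ≤ (maxCharDegree G : ℝ) ^ (s - t) * (χ 1).re ^ t := by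
    intro χ hχ
    have hpos : (0 : ℝ) < ((deg χ : ℕ) : ℝ) := by
      exact_mod_cast pos_of_mem_charDegrees (hdegmem χ hχ)
    have hle : ((deg χ : ℕ) : ℝ) ≤ maxCharDegree G := by
      exact_mod_cast le_maxCharDegree (bddAbove_charDegrees' G) (hdegmem χ hχ)
    rw [hdeg χ hχ, Complex.natCast_re]
    calc ((deg χ : ℕ) : ℝ) ^ s = ((deg χ : ℕ) : ℝ) ^ (s - t) * ((deg χ : ℕ) : ℝ) ^ t := by
          rw [← Real.rpow_add hpos]; ring_nf
      _ ≤ (maxCharDegree G : ℝ) ^ (s - t) * ((deg χ : ℕ) : ℝ) ^ t := by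
          gcongr
  unfold charDegreePowSum
  rw [finsum_mem_eq_finite_toFinset_sum _ hfin, finsum_mem_eq_finite_toFinset_sum _ hfin, Finset.mul_sum]
  exact Finset.sum_le_sum hterm

/-! ### The criterion: STPP families -/

section STPP

variable {H : Type} [Group H] [Fintype H] [DecidableEq H] {n : ℕ} {A B C : Fin n → Finset H}

/-- Per-triple monotonicity: if `d³ ≤ V` (`d ≥ 1`) and `w ≤ s`, then `V^{w/3} · d^{s−w} ≤ V^{s/3}`.
[folklore] -/
theorem rpow_div_three_mul_rpow_le {d V : ℕ} (hd1 : 1 ≤ d) (hbig : d ^ 3 ≤ V) {w s : ℝ} (hws : w ≤ s) :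
    (V : ℝ) ^ (w / 3) * (d : ℝ) ^ (s - w) ≤ (V : ℝ) ^ (s / 3) := by
  have hdpos : (0 : ℝ) < d := by exact_mod_cast hd1
  have hVpos : (0 : ℝ) < (V : ℝ) := by
    have h3 : 0 < d ^ 3 := pow_pos hd1 3
    exact_mod_cast lt_of_lt_of_le h3 hbig
  have hd3 : (d : ℝ) ^ (3 : ℝ) ≤ (V : ℝ) := by
    rw [show (3 : ℝ) = ((3 : ℕ) : ℝ) by norm_num, Real.rpow_natCast]; exact_mod_cast hbig
  have hexp : 0 ≤ (s - w) / 3 := by linarith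
  have hmono : ((d : ℝ) ^ (3 : ℝ)) ^ ((s - w) / 3) ≤ (V : ℝ) ^ ((s - w) / 3) :=
    Real.rpow_le_rpow (by positivity) hd3 hexp
  rw [← Real.rpow_mul hdpos.le, show (3 : ℝ) * ((s - w) / 3) = s - w by ring] at hmono
  calc (V : ℝ) ^ (w / 3) * (d : ℝ) ^ (s - w)
      ≤ (V : ℝ) ^ (w / 3) * (V : ℝ) ^ ((s - w) / 3) := by gcongr
    _ = (V : ℝ) ^ (s / 3) := by rw [← Real.rpow_add hVpos]; ring_nf

/-- **Full degree-multiset row.** Let `(Aᵢ, Bᵢ, Cᵢ)_{i<n}` satisfy the simultaneous triple product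
property (CKSU Def. 5.1) in a finite group `H`, with every volume `Vᵢ = |Aᵢ||Bᵢ||Cᵢ| ≥ d_max(H)³`.  If for
a real `w` the degree power sum satisfies `Σ_χ χ(1)^w < Σᵢ Vᵢ^{w/3}`, then `ω ≤ w`.
(Were `ω > w`: `Vᵢ^{ω/3} ≥ d_max^{ω−w} Vᵢ^{w/3}` and `Σ_χ χ(1)^ω ≤ d_max^{ω−w} Σ_χ χ(1)^w`, so CKSU Thm. 5.5
`Σᵢ Vᵢ^{ω/3} ≤ Σ_χ χ(1)^ω` would give `Σᵢ Vᵢ^{w/3} ≤ Σ_χ χ(1)^w`.)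
[cite: CohnKleinbergSzegedyUmans2005, Thm. 5.5 and Def. 5.1] -/
theorem omega_le_of_stpp_charDegreePowSum (hS : SimultaneousTPP A B C) {w : ℝ}
    (hbig : ∀ i, maxCharDegree H ^ 3 ≤ (A i).card * (B i).card * (C i).card)
    (hcert : charDegreePowSum H w <
      ∑ i, (((A i).card * (B i).card * (C i).card : ℕ) : ℝ) ^ (w / 3)) :
    omega ℂ ≤ w := by
  by_contra hlt
  rw [not_le] at hlt
  set d : ℕ := maxCharDegree H with hd
  have hd1 : 1 ≤ d := one_le_maxCharDegree' H
  have hdpos : (0 : ℝ) < d := by exact_mod_cast hd1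
  have h55 := CohnKleinbergSzegedyUmans2005_thm55_general hS
  have hdeg : charDegreePowSum H (omega ℂ) ≤ (d : ℝ) ^ (omega ℂ - w) * charDegreePowSum H w :=
    charDegreePowSum_le_maxCharDegree_rpow_mul H hlt.le
  have hsum : (∑ i, (((A i).card * (B i).card * (C i).card : ℕ) : ℝ) ^ (w / 3)) *
      (d : ℝ) ^ (omega ℂ - w) ≤ charDegreePowSum H w * (d : ℝ) ^ (omega ℂ - w) := by
    rw [Finset.sum_mul, mul_comm (charDegreePowSum H w)]
    refine (Finset.sum_le_sum fun i _ => rpow_div_three_mul_rpow_le hd1 (hbig i) hlt.le).trans ?_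
    exact h55.trans hdeg
  have hE : 0 < (d : ℝ) ^ (omega ℂ - w) := Real.rpow_pos_of_pos hdpos _
  have := le_of_mul_le_mul_right hsum hE
  linarith

/-- **`d_max` row, real exponent.** Let `(Aᵢ, Bᵢ, Cᵢ)_{i<n}` be an STPP family in a finite group `H` all
of whose character degrees are `≤ d` (`1 ≤ d`), with volumes `Vᵢ ≥ d³`.  If `d^{w−2}|H| < Σᵢ Vᵢ^{w/3}`
for a real `w`, then `ω ≤ w` (CKSU Thm. 5.5 with Cor. 1.9's estimate `Σ_χ χ(1)^ω ≤ d^{ω−2}|H|`, and the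
per-triple monotonicity `Vᵢ^{ω/3} ≥ d^{ω−w}Vᵢ^{w/3}`).
[cite: CohnKleinbergSzegedyUmans2005, Thm. 5.5, Cor. 1.9 and Def. 5.1] -/
theorem omega_le_of_stpp_maxCharDegree (hS : SimultaneousTPP A B C) {d : ℕ} (hd1 : 1 ≤ d)
    (hdmax : maxCharDegree H ≤ d) {w : ℝ}
    (hbig : ∀ i, d ^ 3 ≤ (A i).card * (B i).card * (C i).card)
    (hcert : (d : ℝ) ^ (w - 2) * Fintype.card H <
      ∑ i, (((A i).card * (B i).card * (C i).card : ℕ) : ℝ) ^ (w / 3)) :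
    omega ℂ ≤ w := by
  by_contra hlt
  rw [not_le] at hlt
  have hdpos : (0 : ℝ) < d := by exact_mod_cast hd1
  have h55 : ∑ i, (((A i).card * (B i).card * (C i).card : ℕ) : ℝ) ^ (omega ℂ / 3) ≤
      (d : ℝ) ^ (omega ℂ - 2) * Fintype.card H := by
    refine (CohnKleinbergSzegedyUmans2005_thm55_general_maxCharDegree hS).trans ?_
    refine mul_le_mul_of_nonneg_right ?_ (Nat.cast_nonneg _)
    exact Real.rpow_le_rpow (Nat.cast_nonneg _) (by exact_mod_cast hdmax)
      (sub_nonneg.2 (omega_two_le (K := ℂ)))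
  have hsplit : (d : ℝ) ^ (omega ℂ - 2) * Fintype.card H =
      ((d : ℝ) ^ (w - 2) * Fintype.card H) * (d : ℝ) ^ (omega ℂ - w) := by
    rw [mul_right_comm, ← Real.rpow_add hdpos]; ring_nf
  have hsum : (∑ i, (((A i).card * (B i).card * (C i).card : ℕ) : ℝ) ^ (w / 3)) *
      (d : ℝ) ^ (omega ℂ - w) ≤ ((d : ℝ) ^ (w - 2) * Fintype.card H) * (d : ℝ) ^ (omega ℂ - w) := by
    rw [Finset.sum_mul, ← hsplit]
    exact (Finset.sum_le_sum fun i _ => rpow_div_three_mul_rpow_le hd1 (hbig i) hlt.le).trans h55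
  have hE : 0 < (d : ℝ) ^ (omega ℂ - w) := Real.rpow_pos_of_pos hdpos _
  have := le_of_mul_le_mul_right hsum hE
  linarith

/-- **Abelian-subgroup row, real exponent** (hosts with an abelian subgroup `N` of index `t`: dihedral,
dicyclic, abelian-by-cyclic, …): all character degrees are `≤ t = [H:N]` (tree `maxCharDegree_le_index`),
so volumes `Vᵢ ≥ t³` and `t^{w−2}|H| < Σᵢ Vᵢ^{w/3}` certify `ω ≤ w`.
[cite: CohnKleinbergSzegedyUmans2005, Thm. 5.5, Cor. 1.9, §1.2 and Def. 5.1] -/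
theorem omega_le_of_stpp_abelianSubgroup (hS : SimultaneousTPP A B C) (N : Subgroup H)
    [IsMulCommutative N] {w : ℝ}
    (hbig : ∀ i, N.index ^ 3 ≤ (A i).card * (B i).card * (C i).card)
    (hcert : (N.index : ℝ) ^ (w - 2) * Fintype.card H <
      ∑ i, (((A i).card * (B i).card * (C i).card : ℕ) : ℝ) ^ (w / 3)) :
    omega ℂ ≤ w := by
  haveI : N.FiniteIndex := Subgroup.finiteIndex_of_finite
  exact omega_le_of_stpp_maxCharDegree hS
    (Nat.one_le_iff_ne_zero.mpr Subgroup.FiniteIndex.index_ne_zero) (maxCharDegree_le_index N) hbig hcert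

end STPP

/-! ### The criterion: one TPP triple -/

section TPP

variable {G : Type} [Group G] [Fintype G]

omit [Fintype G] in
/-- A single triple with the triple product property is an STPP family indexed by `Fin 1` (clause (ii)
of CKSU Def. 5.1 is vacuous for one index). [cite: CohnKleinbergSzegedyUmans2005, Def. 5.1] -/
theorem simultaneousTPP_fin_one {S T U : Finset G} (h : TripleProductProperty S T U) :
    SimultaneousTPP (fun _ : Fin 1 => S) (fun _ : Fin 1 => T) (fun _ : Fin 1 => U) :=
  ⟨fun _ => h, fun i j k _ _ _ _ _ _ _ _ _ _ _ _ _ => ⟨Subsingleton.elim i j, Subsingleton.elim j k⟩⟩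

/-- **One TPP triple, real exponent** (Cohn–Umans 2003 Cor. 4.2 / CKSU Cor. 1.9 in certificate form):
if `S, T, U ⊆ G` satisfy the triple product property, every character degree of `G` is `≤ d` (`1 ≤ d`),
`d³ ≤ V := |S||T||U|` and `d^{w−2}|G| < V^{w/3}`, then `ω ≤ w`.
[cite: CohnKleinbergSzegedyUmans2005, Cor. 1.9] [cite: CohnUmans2003, Cor. 4.2] -/
theorem omega_le_of_tpp_maxCharDegree [DecidableEq G] {S T U : Finset G}
    (h : TripleProductProperty S T U) {d : ℕ} (hd1 : 1 ≤ d) (hdmax : maxCharDegree G ≤ d) {w : ℝ}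
    (hbig : d ^ 3 ≤ S.card * T.card * U.card)
    (hcert : (d : ℝ) ^ (w - 2) * Fintype.card G < ((S.card * T.card * U.card : ℕ) : ℝ) ^ (w / 3)) :
    omega ℂ ≤ w := by
  refine omega_le_of_stpp_maxCharDegree (simultaneousTPP_fin_one h) hd1 hdmax (fun _ => hbig) ?_
  simpa using hcert

/-- **One TPP triple, full degree multiset**: `d_max(G)³ ≤ V` and `Σ_χ χ(1)^w < V^{w/3}` give `ω ≤ w`
(CKSU Thm. 1.8 `V^{ω/3} ≤ Σ_χ χ(1)^ω` and monotonicity). [cite: CohnKleinbergSzegedyUmans2005, Thm. 1.8] -/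
theorem omega_le_of_tpp_charDegreePowSum [DecidableEq G] {S T U : Finset G}
    (h : TripleProductProperty S T U) {w : ℝ} (hbig : maxCharDegree G ^ 3 ≤ S.card * T.card * U.card)
    (hcert : charDegreePowSum G w < ((S.card * T.card * U.card : ℕ) : ℝ) ^ (w / 3)) :
    omega ℂ ≤ w := by
  refine omega_le_of_stpp_charDegreePowSum (simultaneousTPP_fin_one h) (fun _ => hbig) ?_
  simpa using hcert

end TPP

/-! ### Families ⇒ `ω(ℂ) = 2` -/

/-- `ω ≤ 2` as soon as `ω ≤ 2 + c·ε` for every `ε > 0` (`c ≥ 0` fixed). [folklore] -/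
theorem omega_le_two_of_forall_pos {c : ℝ} (hc : 0 ≤ c) (h : ∀ ε : ℝ, 0 < ε → omega ℂ ≤ 2 + c * ε) :
    omega ℂ ≤ 2 := by
  refine le_of_forall_pos_lt_add fun δ hδ => ?_
  have h1 := h (δ / (2 * (c + 1))) (by positivity)
  have h2 : c * (δ / (2 * (c + 1))) < δ := by
    rw [mul_div_assoc']
    rw [div_lt_iff₀ (by positivity)]
    nlinarith
  linarith

/-- **The crux `CNonabelianTPPFamilies` (stmt-MatrixMultiplication-0597) as typed implies the summit
statement `ω(ℂ) = 2`.**  For each `ε > 0` the crux supplies a finite group `G` and a TPP triple of volume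
`V ≥ 2` with `|G| ≤ V^{(2+ε)/3}` and `d_max(G) ≤ V^{ε/3}`; CKSU Cor. 1.9 `V^{ω/3} ≤ d_max^{ω−2}|G|` then reads
`V^{ω/3} ≤ V^{ε(ω−2)/3} V^{(2+ε)/3}`, i.e. `ω ≤ 2 + ε(ω−1) ≤ 2 + 2ε`; let `ε → 0` and use `ω ≥ 2`.
(The route file links only the abelian target `CThesis` to the summit; this is the non-abelian bridge.
NB the refuter note on the item argues the clause `d_max ≤ V^{ε/3}` is too strong — see
`matrixMultiplication_of_tppFamilies_theta` for the repaired form.)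
[cite: CohnKleinbergSzegedyUmans2005, Cor. 1.9] [cite: CohnUmans2003, Cor. 4.3] -/
theorem matrixMultiplication_of_CNonabelianTPPFamilies
    (hC : Summit.MatrixMultiplication.MatrixMultiplication.Theses.GroupTheoreticSTPP.CNonabelianTPPFamilies) :
    _root_.MatrixMultiplication := by
  rw [_root_.MatrixMultiplication_iff, omega_eq_two_iff_omega_le_two]
  have hω3 : omega ℂ ≤ 3 := omega_le_three' (K := ℂ)
  have hω2 : 2 ≤ omega ℂ := omega_two_le ℂ
  refine omega_le_two_of_forall_pos (c := 2) (by norm_num) fun ε hε => ?_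
  obtain ⟨G, _, _, S, T, U, htpp, hn₀, hcard, hdeg⟩ := hC ε hε 2
  classical
  set V : ℕ := S.card * T.card * U.card with hV
  have hV2 : (2 : ℝ) ≤ (V : ℝ) := by exact_mod_cast hn₀
  have hV1 : (1 : ℝ) < (V : ℝ) := by linarith
  have hVpos : (0 : ℝ) < (V : ℝ) := by linarith
  -- CKSU Cor. 1.9 for the realization `⟨|S|,|T|,|U|⟩`
  have hr : RealizesTPP G S.card T.card U.card := ⟨S, T, U, rfl, rfl, rfl, htpp⟩
  have h19 := CKSU2005_cor19_holds G _ _ _ hr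
  rw [Nat.card_eq_fintype_card] at h19
  -- `d_max^{ω-2} ≤ V^{ε(ω-2)/3}`
  have hd : (maxCharDegree G : ℝ) ^ (omega ℂ - 2) ≤ ((V : ℝ) ^ (ε / 3)) ^ (omega ℂ - 2) :=
    Real.rpow_le_rpow (Nat.cast_nonneg _) hdeg (by linarith)
  rw [← Real.rpow_mul hVpos.le] at hd
  have hchain : (V : ℝ) ^ (omega ℂ / 3) ≤ (V : ℝ) ^ (ε / 3 * (omega ℂ - 2) + (2 + ε) / 3) := by
    calc (V : ℝ) ^ (omega ℂ / 3) ≤ (maxCharDegree G : ℝ) ^ (omega ℂ - 2) * Fintype.card G := h19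
      _ ≤ (V : ℝ) ^ (ε / 3 * (omega ℂ - 2)) * (V : ℝ) ^ ((2 + ε) / 3) := by gcongr
      _ = (V : ℝ) ^ (ε / 3 * (omega ℂ - 2) + (2 + ε) / 3) := by rw [← Real.rpow_add hVpos]
  have hexp : omega ℂ / 3 ≤ ε / 3 * (omega ℂ - 2) + (2 + ε) / 3 :=
    (Real.rpow_le_rpow_left_iff hV1).1 hchain
  nlinarith

/-- **The repaired crux `C′` implies `ω(ℂ) = 2`.**  With a FIXED `θ < 1` and, for every `ε > 0`, a TPP
triple of volume `V ≥ 2` in a finite group `G` with `|G| ≤ V^{(2+ε)/3}` and `d_max(G) ≤ V^{θ/3}`,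
CKSU Cor. 1.9 gives `ω ≤ θ(ω−2) + 2 + ε`, i.e. `ω ≤ 2 + ε/(1−θ)`; hence `ω = 2`.  This is the regime of
Cohn–Umans 2003 Cor. 4.3 ("if `α(G) − 2 = o(γ(G) − 2)` then `ω = 2`") with `γ` bounded away from `2`.
[cite: CohnUmans2003, Cor. 4.3] [cite: CohnKleinbergSzegedyUmans2005, Cor. 1.9] -/
theorem matrixMultiplication_of_tppFamilies_theta
    (hC : ∃ θ : ℝ, θ < 1 ∧ ∀ ε : ℝ, 0 < ε → ∀ n₀ : ℕ, ∃ (G : Type) (_ : Group G) (_ : Fintype G)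
      (S T U : Finset G), (∀ s ∈ S, ∀ s' ∈ S, ∀ t ∈ T, ∀ t' ∈ T, ∀ u ∈ U, ∀ u' ∈ U,
        (s * s'⁻¹) * (t * t'⁻¹) * (u * u'⁻¹) = 1 → s = s' ∧ t = t' ∧ u = u') ∧
      (n₀ : ℝ) ≤ ((S.card * T.card * U.card : ℕ) : ℝ) ∧
      (Fintype.card G : ℝ) ≤ ((S.card * T.card * U.card : ℕ) : ℝ) ^ ((2 + ε) / 3) ∧
      (maxCharDegree G : ℝ) ≤ ((S.card * T.card * U.card : ℕ) : ℝ) ^ (θ / 3)) :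
    _root_.MatrixMultiplication := by
  rw [_root_.MatrixMultiplication_iff, omega_eq_two_iff_omega_le_two]
  obtain ⟨θ, hθ, hC⟩ := hC
  have hω3 : omega ℂ ≤ 3 := omega_le_three' (K := ℂ)
  have hω2 : 2 ≤ omega ℂ := omega_two_le ℂ
  have h1θ : 0 < 1 - θ := by linarith
  refine omega_le_two_of_forall_pos (c := 1 / (1 - θ)) (by positivity) fun ε hε => ?_
  obtain ⟨G, _, _, S, T, U, htpp, hn₀, hcard, hdeg⟩ := hC ε hε 2
  classical
  set V : ℕ := S.card * T.card * U.card with hV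
  have hV2 : (2 : ℝ) ≤ (V : ℝ) := by exact_mod_cast hn₀
  have hV1 : (1 : ℝ) < (V : ℝ) := by linarith
  have hVpos : (0 : ℝ) < (V : ℝ) := by linarith
  have hr : RealizesTPP G S.card T.card U.card := ⟨S, T, U, rfl, rfl, rfl, htpp⟩
  have h19 := CKSU2005_cor19_holds G _ _ _ hr
  rw [Nat.card_eq_fintype_card] at h19
  have hd : (maxCharDegree G : ℝ) ^ (omega ℂ - 2) ≤ ((V : ℝ) ^ (θ / 3)) ^ (omega ℂ - 2) :=
    Real.rpow_le_rpow (Nat.cast_nonneg _) hdeg (by linarith)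
  rw [← Real.rpow_mul hVpos.le] at hd
  have hchain : (V : ℝ) ^ (omega ℂ / 3) ≤ (V : ℝ) ^ (θ / 3 * (omega ℂ - 2) + (2 + ε) / 3) := by
    calc (V : ℝ) ^ (omega ℂ / 3) ≤ (maxCharDegree G : ℝ) ^ (omega ℂ - 2) * Fintype.card G := h19
      _ ≤ (V : ℝ) ^ (θ / 3 * (omega ℂ - 2)) * (V : ℝ) ^ ((2 + ε) / 3) := by gcongr
      _ = (V : ℝ) ^ (θ / 3 * (omega ℂ - 2) + (2 + ε) / 3) := by rw [← Real.rpow_add hVpos]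
  have hexp : omega ℂ / 3 ≤ θ / 3 * (omega ℂ - 2) + (2 + ε) / 3 :=
    (Real.rpow_le_rpow_left_iff hV1).1 hchain
  -- `ω (1 - θ) ≤ 2 (1 - θ) + ε`
  have hkey : omega ℂ * (1 - θ) ≤ 2 * (1 - θ) + ε := by nlinarith
  have : omega ℂ ≤ 2 + ε / (1 - θ) := by
    rw [show 2 + ε / (1 - θ) = (2 * (1 - θ) + ε) / (1 - θ) by field_simp]
    rw [le_div_iff₀ h1θ]
    exact hkey
  simpa [one_div, div_eq_inv_mul, mul_comm] using this

/-- **STPP families with a degree bound imply `ω(ℂ) = 2`.**  If for every `ε > 0` some finite group `H`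
carries an STPP family `(Aᵢ, Bᵢ, Cᵢ)_{i<n}` and a bound `d ≥ d_max(H)`, `d ≥ 1`, with all volumes
`Vᵢ ≥ d³` and `d^ε · |H| < Σᵢ Vᵢ^{(2+ε)/3}`, then `ω ≤ 2 + ε` for every `ε` (`omega_le_of_stpp_maxCharDegree`
at `w = 2 + ε`), hence `ω(ℂ) = 2`.  For abelian `H` (`d = 1`) the hypothesis is the route's target
`CThesis` (X_C) restricted to families of volumes `≥ 1`.
[cite: CohnKleinbergSzegedyUmans2005, Thm. 5.5 and Cor. 1.9] -/
theorem matrixMultiplication_of_stppFamilies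
    (hC : ∀ ε : ℝ, 0 < ε → ∃ (H : Type) (_ : Group H) (_ : Fintype H) (_ : DecidableEq H) (n : ℕ)
      (A B C : Fin n → Finset H) (d : ℕ), SimultaneousTPP A B C ∧ 1 ≤ d ∧ maxCharDegree H ≤ d ∧
      (∀ i, d ^ 3 ≤ (A i).card * (B i).card * (C i).card) ∧
      (d : ℝ) ^ ε * Fintype.card H <
        ∑ i, (((A i).card * (B i).card * (C i).card : ℕ) : ℝ) ^ ((2 + ε) / 3)) :
    _root_.MatrixMultiplication := by
  rw [_root_.MatrixMultiplication_iff, omega_eq_two_iff_omega_le_two]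
  refine omega_le_two_of_forall_pos (c := 1) zero_le_one fun ε hε => ?_
  obtain ⟨H, _, _, _, n, A, B, C, d, hS, hd1, hdmax, hbig, hcert⟩ := hC ε hε
  rw [one_mul]
  refine omega_le_of_stpp_maxCharDegree hS hd1 hdmax hbig ?_
  rwa [show 2 + ε - 2 = ε by ring]

end STPPCriterion

end Summit.MatrixMultiplication.MatrixMultiplication.Theorems

end
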